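import Literature.NumberTheory.Transcendental.NesterenkoElimIdealPrime
import Literature.RingTheory.NoetherNormalization.GenericLinearFormsExtra
import Literature.RingTheory.KrullDimension.AffineCatenary
import Literature.RingTheory.MvPolynomial.HomogeneousDimension
import Mathlib.RingTheory.Ideal.UFD
import Mathlib.RingTheory.KrullDimension.Polynomial
import Mathlib.RingTheory.KrullDimension.Field
import Mathlib.RingTheory.MvPolynomial.Homogeneous
import HarnessLib

/-!
# The Chow form of a homogeneous prime ideal: `p̄(r)` is a non-zero principal prime (LNM 1752 Ch. 3 Prop. 4.4, prime case) — PROVED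

`Literature/NumberTheory/Transcendental/NesterenkoChowFormPrime.lean` — proofs only (no
definitions, nothing asserted). Sequel of `NesterenkoElimIdealPrime.lean` (where, for a prime
`𝔭 ⊂ K[x₀, …, x_m]` and a variable `xⱼ ∉ 𝔭`, the elimination ideal `Ī(r) ⊂ K[U]` of
Definition 4.3 was identified with the kernel of `Φⱼ : K[U] → K(𝔭)[U]`,
`u_{ik} ↦ u_{ik}` (`k ≠ j`), `u_{ij} ↦ −(∑_{k≠j} u_{ik} x̄ₖ)/x̄ⱼ`, and shown to be prime). Here we
prove, for `K` an infinite field and `𝔭` a HOMOGENEOUS prime with `dim K[x̲]/𝔭 = r ≥ 1`: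

* `NesterenkoK.ringKrullDim_quotient_elimIdeal` — **`dim K[U]/p̄(r) = r(m+1) − 1`**;
* `NesterenkoK.height_elimIdeal_eq_one` — `p̄(r)` has height one;
* `NesterenkoK.isPrincipal_elimIdeal` — **`p̄(r)` is a non-zero principal prime ideal of `K[U]`**
  (height-one primes of the UFD `K[U]` are principal), i.e. LNM 1752 Ch. 3 Proposition 4.4 for a
  prime ideal = Philippon, Publ. Math. IHÉS 64 (1986) Prop. 1.5 (ii)–(iii) = Hodge–Pedoe II,
  Ch. X §6 Thm. I ("the Cayley form");

and, for `K = ℚ` and the objects of `NesterenkoElimination.lean`, EXACTLY the hypotheses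
(1) (first half) and (2) of the reduction `Nesterenko.NesterenkoPhilippon2001_ch3_prop_4_4_of`
(`NesterenkoEliminationProofs.lean`) of the named fact `NesterenkoPhilippon2001_ch3_prop_4_4`:
`Nesterenko.isPrime_elimIdeal_of_not_span_X_le`, `Nesterenko.isPrincipal_elimIdeal_and_ne_bot`;
moreover `Nesterenko.prime_chowForm` (the associated form `chowForm 𝔭 r` is a prime element)
and `Nesterenko.span_chowForm_eq_elimIdeal`.

## The proof

`K[U]/Ī(r) ≅ Φⱼ(K[U]) = K[f]`, `f` the values of `Φⱼ` on the `u_{ik}`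
(`ringKrullDim_quotient_elimIdeal_eq`, `trdeg_range_eq_trdeg_adjoin`); so
`dim K[U]/Ī(r) = trdeg_K K[f]`, computed inside `Ω = Frac(K(𝔭)[U])`:

* `trdeg_K K[x̄ₖ/x̄ⱼ : k] = r − 1` (`trdeg_adjoin_ratio_eq`): `x̄ⱼ` is transcendental over the
  ratios (`transcendental_xbar_adjoin_ratio` — every element of `K[ratios]` is `A(x̄)/x̄ⱼ^N` with
  `A` a form of degree `N` (`exists_isHomogeneous_of_mem_adjoin_ratio`), so a relation for `x̄ⱼ`
  over the ratios gives a polynomial of `𝔭` whose homogeneous pieces `Aᵢ xⱼ^{…}` lie in the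
  HOMOGENEOUS prime `𝔭 ∌ xⱼ`), while `K[ratios, x̄ⱼ] ⊇ K[x̄] ≅ K[x̲]/𝔭` has transcendence degree
  `r` (`trdeg_adjoin_range_xbar`, `dim = trdeg` for affine domains);
* upper bound `trdeg K[f] ≤ rm + (r − 1)` (`trdeg_adjoin_pivot_le`): `K[f] ⊆ K[ratios, u_{ik}
  (k ≠ j)]`;
* lower bound (`le_trdeg_adjoin_pivot`): the `rm` variables `u_{ik}` (`k ≠ j`) and the `r − 1`
  generic forms `f(i, j) = −∑_{k≠j} (x̄ₖ/x̄ⱼ) u_{ik}`, `i < r − 1`, are algebraically independent over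
  `K` — the theorem on generic linear forms
  `Literature.RingTheory.NoetherNormalization.algebraicIndependent_sumElim_genericLinearForms'`;
* hence height `= r(m+1) − (rm + r − 1) = 1` by the dimension formula for affine domains
  (`Literature.RingTheory.KrullDimension.ringKrullDim_quotient_add_height`), and a height-one
  prime of a UFD is principal (`UniqueFactorizationMonoid.isPrincipal_of_height_eq_one`).

Two transcendence-degree tools are proved on the way
(`Literature.RingTheory.NoetherNormalization.trdeg_adjoin_le_trdeg_adjoin_of_forall_isAlgebraic`,
`…trdeg_adjoin_add_one_le_of_transcendental`).

## References

* [NesterenkoPhilippon2001] Yu. V. Nesterenko, P. Philippon (eds.), *Introduction to Algebraic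
  Independence Theory*, LNM 1752, Springer 2001, Ch. 3 §4 Prop. 4.4 (p. 38).
* [Philippon1986Criteres] P. Philippon, *Critères pour l'indépendance algébrique*, Publ. Math.
  IHÉS 64 (1986) 5–52, §1 Prop. 1.3 (ii), Prop. 1.5 (ii)–(iii), Lemme 1.2.
* [HodgePedoe1994] W. V. D. Hodge, D. Pedoe, *Methods of Algebraic Geometry* II, Ch. X §6 Thm. I.
* [Nes10] Yu. V. Nesterenko, Proc. Steklov Inst. Math. 218 (1997) 294–331, §1 Prop. 1.1.
-/

noncomputable section

open MvPolynomial Cardinal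

namespace Literature.RingTheory.NoetherNormalization

/-! ### Two more transcendence-degree tools -/

variable {K : Type*} [Field K] {F : Type*} [Field F] [Algebra K F]

/-- If `s` is algebraic over `K[t]` then `trdeg_K K[s] ≤ trdeg_K K[t]`. [folklore] -/
theorem trdeg_adjoin_le_trdeg_adjoin_of_forall_isAlgebraic {s t : Set F}
    (h : ∀ x ∈ s, IsAlgebraic (Algebra.adjoin K t) x) :
    Algebra.trdeg K (Algebra.adjoin K s) ≤ Algebra.trdeg K (Algebra.adjoin K t) := by
  set A : Subalgebra K F := Algebra.adjoin K t with hA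
  set t' : Set A := ((↑) : A → F) ⁻¹' t with ht'
  obtain ⟨e, he⟩ := exists_algEquiv_adjoin_preimage (K := K) A (t := t)
    (fun x hx => Algebra.subset_adjoin hx)
  haveI : Algebra.IsAlgebraic (Algebra.adjoin K t') A := by
    refine ⟨fun a => ?_⟩
    have ha : IsAlgebraic (Algebra.adjoin K t) (a : F) := isAlgebraic_algebraMap a
    refine ha.of_ringHom_of_comp_eq (f := (e : Algebra.adjoin K t' →+* Algebra.adjoin K t))
      (g := (A.val : A →+* F)) e.surjective Subtype.val_injective ?_
    ext x
    simp only [RingHom.coe_comp, Function.comp_apply]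
    exact he x
  obtain ⟨B, hBt, hB⟩ := exists_isTranscendenceBasis_subset (R := K) (A := A) t'
  have hcard : #B = Algebra.trdeg K A := hB.cardinalMk_eq_trdeg
  haveI halg : Algebra.IsAlgebraic (Algebra.adjoin K (Set.range ((↑) : B → A))) A := hB.isAlgebraic
  set B' : Set F := ((↑) : A → F) '' B with hB'
  obtain ⟨e', he'⟩ := exists_algEquiv_adjoin_preimage (K := K) A (t := B')
    (by rintro _ ⟨b, hb, rfl⟩; exact b.2)
  have hpre : ((↑) : A → F) ⁻¹' B' = Set.range ((↑) : B → A) := by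
    ext a
    simp only [hB', Set.mem_preimage, Set.mem_image, Set.mem_range]
    constructor
    · rintro ⟨b, hb, hba⟩
      exact ⟨⟨b, hb⟩, Subtype.val_injective hba⟩
    · rintro ⟨b, rfl⟩
      exact ⟨b, b.2, rfl⟩
  -- every element of `t` is algebraic over `K[B']`
  have htalg : ∀ x ∈ t, IsAlgebraic (Algebra.adjoin K B') x := by
    intro x hxt
    have hxA : IsAlgebraic (Algebra.adjoin K (Set.range ((↑) : B → A)))
        (⟨x, Algebra.subset_adjoin hxt⟩ : A) := halg.isAlgebraic _
    rw [← hpre] at hxA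
    have := hxA.ringHom_of_comp_eq (f := (e' : Algebra.adjoin K (((↑) : A → F) ⁻¹' B') →+*
        Algebra.adjoin K B')) (g := (A.val : A →+* F)) e'.injective ?_
    · exact this
    · ext z
      simp only [RingHom.coe_comp, Function.comp_apply]
      exact he' z
  -- hence so is every element of `s`
  have hsalg : ∀ x ∈ s, IsAlgebraic (Algebra.adjoin K B') x := fun x hx =>
    (h x hx).adjoin_of_forall_isAlgebraic fun y hy => htalg y hy.1
  calc Algebra.trdeg K (Algebra.adjoin K s) ≤ #B' := trdeg_adjoin_le_of_forall_isAlgebraic hsalg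
    _ = Algebra.trdeg K A := by rw [hB', Cardinal.mk_image_eq Subtype.val_injective, hcard]

/-- Adjoining an element transcendental over `K[S]` raises the transcendence degree:
`trdeg_K K[S] + 1 ≤ trdeg_K K[S ∪ {a}]`. [folklore] -/
theorem trdeg_adjoin_add_one_le_of_transcendental {S : Set F} {a : F}
    (ha : Transcendental (Algebra.adjoin K S) a) :
    Algebra.trdeg K (Algebra.adjoin K S) + 1 ≤ Algebra.trdeg K (Algebra.adjoin K (insert a S)) := by
  set A : Subalgebra K F := Algebra.adjoin K S with hA
  set s' : Set A := ((↑) : A → F) ⁻¹' S with hs'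
  obtain ⟨e, he⟩ := exists_algEquiv_adjoin_preimage (K := K) A (t := S)
    (fun x hx => Algebra.subset_adjoin hx)
  haveI : Algebra.IsAlgebraic (Algebra.adjoin K s') A := by
    refine ⟨fun b => ?_⟩
    have hb : IsAlgebraic (Algebra.adjoin K S) (b : F) := isAlgebraic_algebraMap b
    refine hb.of_ringHom_of_comp_eq (f := (e : Algebra.adjoin K s' →+* Algebra.adjoin K S))
      (g := (A.val : A →+* F)) e.surjective Subtype.val_injective ?_
    ext x
    simp only [RingHom.coe_comp, Function.comp_apply]
    exact he x
  obtain ⟨B, hBs, hB⟩ := exists_isTranscendenceBasis_subset (R := K) (A := A) s'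
  have hcard : #B = Algebra.trdeg K A := hB.cardinalMk_eq_trdeg
  set A₁ : Subalgebra K F := Algebra.adjoin K (insert a S) with hA₁
  have hle : A ≤ A₁ := Algebra.adjoin_mono (Set.subset_insert a S)
  -- the family `(B, a)` inside `K[S ∪ {a}]`
  let xB : B → A₁ := fun b => ⟨((b : A) : F), hle b.1.2⟩
  let x : Option B → A₁ := fun o => o.elim ⟨a, Algebra.subset_adjoin (Set.mem_insert a S)⟩ xB
  have hxB : AlgebraicIndependent K xB := by
    refine AlgebraicIndependent.of_comp A₁.val ?_
    have : (A₁.val : A₁ → F) ∘ xB = (A.val : A → F) ∘ ((↑) : B → A) := by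
      funext b; rfl
    rw [this]
    exact hB.1.map' (f := A.val) (fun u v huv => Subtype.ext huv)
  have hx : AlgebraicIndependent K x := by
    rw [hxB.option_iff_transcendental]
    -- transport `ha` along the inclusion `K[range xB] ↪ K[S]`
    have hmem : ∀ z : Algebra.adjoin K (Set.range xB), ((z : A₁) : F) ∈ Algebra.adjoin K S := by
      intro z
      have h1 : ((z : A₁) : F) ∈ (Algebra.adjoin K (Set.range xB)).map A₁.val := ⟨z, z.2, rfl⟩
      rw [AlgHom.map_adjoin] at h1
      refine Algebra.adjoin_mono ?_ h1
      rintro _ ⟨_, ⟨b, rfl⟩, rfl⟩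
      exact hBs b.2
    let f : Algebra.adjoin K (Set.range xB) →ₐ[K] Algebra.adjoin K S :=
      (A₁.val.comp (Algebra.adjoin K (Set.range xB)).val).codRestrict (Algebra.adjoin K S) hmem
    have hf : Function.Injective f := by
      intro z w hzw
      have h' := congrArg (fun q : Algebra.adjoin K S => (q : F)) hzw
      exact Subtype.ext (Subtype.ext h')
    refine Transcendental.of_ringHom_of_comp_eq (f := (f : _ →+* _)) (g := (A₁.val : A₁ →+* F))
      ha hf ?_
    ext z
    rfl
  have h := hx.cardinalMk_le_trdeg
  rw [Cardinal.mk_option, hcard] at h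
  exact h

end Literature.RingTheory.NoetherNormalization

namespace Literature.NumberTheory.Transcendental

namespace NesterenkoK

attribute [local instance] MvPolynomial.gradedAlgebra

variable {K : Type*} [Field K] {m : ℕ} (𝔭 : Ideal (MvPolynomial (Fin (m + 1)) K)) [𝔭.IsPrime]

/-! ### Ratios of coordinates: every element of `K[x̄ₖ/x̄ⱼ : k]` is `A(x̄)/x̄ⱼ^N` with `A` a form of degree `N` -/

/-- Every element of the `K`-algebra generated by the ratios `x̄ₖ x̄ⱼ⁻¹` is of the form
`A(x̄) · x̄ⱼ^{−N}` with `A ∈ K[x̲]` homogeneous of degree `N`. [folklore] -/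
theorem exists_isHomogeneous_of_mem_adjoin_ratio {j : Fin (m + 1)}
    (hj : (X j : MvPolynomial (Fin (m + 1)) K) ∉ 𝔭) {a : FractionRing (MvPolynomial (Fin (m + 1)) K ⧸ 𝔭)}
    (ha : a ∈ Algebra.adjoin K (Set.range fun k : Fin (m + 1) => xbar 𝔭 k * (xbar 𝔭 j)⁻¹)) :
    ∃ (N : ℕ) (A : MvPolynomial (Fin (m + 1)) K), A.IsHomogeneous N ∧
      a = algebraMap (MvPolynomial (Fin (m + 1)) K) _ A * ((xbar 𝔭 j)⁻¹) ^ N := by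
  have hx : xbar 𝔭 j ≠ 0 := xbar_ne_zero 𝔭 hj
  induction ha using Algebra.adjoin_induction with
  | mem x hx' =>
    obtain ⟨k, rfl⟩ := hx'
    exact ⟨1, X k, isHomogeneous_X K k, by simp [xbar]⟩
  | algebraMap c =>
    refine ⟨0, C c, isHomogeneous_C _ c, ?_⟩
    rw [pow_zero, mul_one, IsScalarTower.algebraMap_apply K (MvPolynomial (Fin (m + 1)) K)]
    simp
  | add x y _ _ hx' hy' =>
    obtain ⟨N₁, A₁, hA₁, rfl⟩ := hx'
    obtain ⟨N₂, A₂, hA₂, rfl⟩ := hy'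
    refine ⟨N₁ + N₂, A₁ * X j ^ N₂ + A₂ * X j ^ N₁,
      (hA₁.mul (isHomogeneous_X_pow j N₂)).add ?_, ?_⟩
    · simpa [add_comm] using hA₂.mul (isHomogeneous_X_pow j N₁)
    · simp only [map_add, map_mul, map_pow]
      rw [← xbar]
      simp only [inv_pow]
      field_simp
      ring
  | mul x y _ _ hx' hy' =>
    obtain ⟨N₁, A₁, hA₁, rfl⟩ := hx'
    obtain ⟨N₂, A₂, hA₂, rfl⟩ := hy'
    refine ⟨N₁ + N₂, A₁ * A₂, hA₁.mul hA₂, ?_⟩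
    rw [map_mul]
    ring

/-- For a homogeneous prime `𝔭 ∌ xⱼ`, the coordinate `x̄ⱼ ∈ K(𝔭)` is transcendental over the
`K`-algebra generated by the ratios `x̄ₖ/x̄ⱼ` (a form vanishing identically in `x̄ⱼ` over the
ratios has all its homogeneous pieces in `𝔭`). [folklore] -/
theorem transcendental_xbar_adjoin_ratio (hhom : 𝔭.IsHomogeneous (homogeneousSubmodule (Fin (m + 1)) K))
    {j : Fin (m + 1)} (hj : (X j : MvPolynomial (Fin (m + 1)) K) ∉ 𝔭) :
    Transcendental (Algebra.adjoin K (Set.range fun k : Fin (m + 1) => xbar 𝔭 k * (xbar 𝔭 j)⁻¹))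
      (xbar 𝔭 j) := by
  classical
  set L := FractionRing (MvPolynomial (Fin (m + 1)) K ⧸ 𝔭) with hL
  set S : Set L := Set.range fun k : Fin (m + 1) => xbar 𝔭 k * (xbar 𝔭 j)⁻¹ with hS
  have hx : xbar 𝔭 j ≠ 0 := xbar_ne_zero 𝔭 hj
  intro halg
  obtain ⟨P, hP0, hPx⟩ := halg
  -- write each coefficient as `A_i(x̄) x̄ⱼ^{-N_i}`
  have hcoef : ∀ i, ∃ (N : ℕ) (A : MvPolynomial (Fin (m + 1)) K), A.IsHomogeneous N ∧
      ((P.coeff i : Algebra.adjoin K S) : L) =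
        algebraMap (MvPolynomial (Fin (m + 1)) K) L A * ((xbar 𝔭 j)⁻¹) ^ N :=
    fun i => exists_isHomogeneous_of_mem_adjoin_ratio 𝔭 hj (P.coeff i).2
  choose N A hA hcA using hcoef
  -- uniformise the exponents
  set M : ℕ := ∑ i ∈ P.support, N i with hM
  have hNle : ∀ i ∈ P.support, N i ≤ M := fun i hi =>
    Finset.single_le_sum (fun _ _ => Nat.zero_le _) hi
  -- the polynomial `R = ∑ A_i xⱼ^{M - N_i + i} ∈ K[x̲]`
  set R : MvPolynomial (Fin (m + 1)) K := ∑ i ∈ P.support, A i * X j ^ (M - N i + i) with hR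
  have hterm : ∀ i ∈ P.support, (A i * X j ^ (M - N i + i)).IsHomogeneous (M + i) := by
    intro i hi
    have := (hA i).mul (isHomogeneous_X_pow (R := K) j (M - N i + i))
    have e : N i + (M - N i + i) = M + i := by have := hNle i hi; omega
    rwa [e] at this
  -- `R(x̄) = x̄ⱼ^M · P(x̄ⱼ) = 0`, so `R ∈ 𝔭`
  have hReval : algebraMap (MvPolynomial (Fin (m + 1)) K) L R =
      xbar 𝔭 j ^ M * (Polynomial.aeval (xbar 𝔭 j) P : L) := by
    rw [Polynomial.aeval_def, Polynomial.eval₂_eq_sum, Polynomial.sum_def, hR, map_sum,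
      Finset.mul_sum]
    refine Finset.sum_congr rfl fun i hi => ?_
    rw [map_mul, map_pow, ← xbar]
    change _ = xbar 𝔭 j ^ M * (((P.coeff i : Algebra.adjoin K S) : L) * xbar 𝔭 j ^ i)
    rw [hcA i]
    have hle := hNle i hi
    obtain ⟨d, hd⟩ := Nat.exists_eq_add_of_le hle
    rw [show M - N i + i = d + i by omega, hd, pow_add, pow_add]
    have h1 : xbar 𝔭 j ^ N i * (xbar 𝔭 j)⁻¹ ^ N i = 1 := by
      rw [← mul_pow, mul_inv_cancel₀ hx, one_pow]
    linear_combination (-(algebraMap (MvPolynomial (Fin (m + 1)) K) L (A i) * xbar 𝔭 j ^ d *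
      xbar 𝔭 j ^ i)) * h1
  have hRmem : R ∈ 𝔭 := by
    rw [← algebraMap_eq_zero_iff 𝔭, hReval, hPx, mul_zero]
  -- the homogeneous components of `R` are the `A_i xⱼ^{M - N_i + i}`, hence `A_i ∈ 𝔭`
  have hcomp : ∀ i ∈ P.support, homogeneousComponent (M + i) R = A i * X j ^ (M - N i + i) := by
    intro i hi
    rw [hR, map_sum]
    have : ∀ i' ∈ P.support, homogeneousComponent (M + i) (A i' * X j ^ (M - N i' + i')) =
        if i' = i then A i * X j ^ (M - N i + i) else 0 := by
      intro i' hi'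
      rw [homogeneousComponent_of_mem ((mem_homogeneousSubmodule _ _).2 (hterm i' hi'))]
      by_cases h : i' = i
      · subst h; simp
      · have h' : M + i ≠ M + i' := by omega
        rw [if_neg h', if_neg h]
    rw [Finset.sum_congr rfl this, Finset.sum_ite_eq' P.support i, if_pos hi]
  have hAmem : ∀ i ∈ P.support, A i ∈ 𝔭 := by
    intro i hi
    have h1 : A i * X j ^ (M - N i + i) ∈ 𝔭 := by
      rw [← hcomp i hi]
      exact homogeneousComponent_mem_of_mem hhom hRmem _
    rcases (inferInstance : 𝔭.IsPrime).mem_or_mem h1 with h | h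
    · exact h
    · exact absurd ((inferInstance : 𝔭.IsPrime).mem_of_pow_mem _ h) hj
  -- so all coefficients of `P` vanish
  have hcoeff0 : ∀ i ∈ P.support, P.coeff i = 0 := by
    intro i hi
    have h1 : ((P.coeff i : Algebra.adjoin K S) : L) = 0 := by
      rw [hcA i, (algebraMap_eq_zero_iff 𝔭 (A i)).2 (hAmem i hi), zero_mul]
    exact Subtype.ext h1
  obtain ⟨i, hi⟩ := Finset.nonempty_of_ne_empty (Polynomial.support_eq_empty.not.2 hP0)
  exact (Polynomial.mem_support_iff.1 hi) (hcoeff0 i hi)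

/-! ### Transcendence degrees: `trdeg K[x̄] = dim`, `trdeg K[x̄ₖ/x̄ⱼ : k] = dim − 1` -/

omit [𝔭.IsPrime] in
/-- `K[x̄₀, …, x̄_m] ⊆ K(𝔭)` is (isomorphic to) `K[x̲]/𝔭`. [folklore] -/
theorem trdeg_adjoin_range_xbar [𝔭.IsPrime] :
    Algebra.trdeg K (Algebra.adjoin K (Set.range (xbar 𝔭))) =
      Algebra.trdeg K (MvPolynomial (Fin (m + 1)) K ⧸ 𝔭) := by
  set A := MvPolynomial (Fin (m + 1)) K with hA
  set L := FractionRing (MvPolynomial (Fin (m + 1)) K ⧸ 𝔭) with hL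
  set φ : A →ₐ[K] L := IsScalarTower.toAlgHom K A L with hφ
  have hrange : φ.range = Algebra.adjoin K (Set.range (xbar 𝔭)) := by
    have h1 : φ = aeval (xbar 𝔭) := by
      refine MvPolynomial.algHom_ext fun k => ?_
      rw [aeval_X]
      rfl
    rw [h1, ← Algebra.adjoin_range_eq_range_aeval]
  have hker : RingHom.ker φ = 𝔭 := by
    ext p
    rw [RingHom.mem_ker]
    exact algebraMap_eq_zero_iff 𝔭 p
  -- `A ⧸ 𝔭 ≃ range φ`
  have e₁ : (A ⧸ RingHom.ker φ.rangeRestrict) ≃ₐ[K] φ.range :=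
    Ideal.quotientKerAlgEquivOfSurjective (AlgHom.rangeRestrict_surjective φ)
  rw [AlgHom.ker_rangeRestrict, hker] at e₁
  rw [← hrange]
  exact e₁.trdeg_eq.symm

variable {𝔭} in
/-- `trdeg_K (K[x̲]/𝔭) = dim (K[x̲]/𝔭)` read as a natural number. [folklore] -/
theorem trdeg_quotient_eq_of_ringKrullDim_eq {r : ℕ}
    (hdim : ringKrullDim (MvPolynomial (Fin (m + 1)) K ⧸ 𝔭) = r) :
    Algebra.trdeg K (MvPolynomial (Fin (m + 1)) K ⧸ 𝔭) = r := by
  have h1 := Literature.RingTheory.KrullDimension.ringKrullDim_eq_trdeg K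
    (MvPolynomial (Fin (m + 1)) K ⧸ 𝔭)
  rw [hdim] at h1
  have h2 : Cardinal.toNat (Algebra.trdeg K (MvPolynomial (Fin (m + 1)) K ⧸ 𝔭)) = r := by
    exact_mod_cast h1.symm
  rw [Literature.RingTheory.KrullDimension.trdeg_eq_toNat K (MvPolynomial (Fin (m + 1)) K ⧸ 𝔭), h2]

/-- Upper bound: `trdeg K[x̄ₖ/x̄ⱼ : k] + 1 ≤ trdeg K[x̄]` (`x̄ⱼ` is transcendental over the ratios,
and everything is algebraic over `K[x̄]`). [folklore] -/
theorem trdeg_adjoin_ratio_add_one_le (hhom : 𝔭.IsHomogeneous (homogeneousSubmodule (Fin (m + 1)) K))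
    {j : Fin (m + 1)} (hj : (X j : MvPolynomial (Fin (m + 1)) K) ∉ 𝔭) :
    Algebra.trdeg K (Algebra.adjoin K (Set.range fun k : Fin (m + 1) => xbar 𝔭 k * (xbar 𝔭 j)⁻¹))
      + 1 ≤ Algebra.trdeg K (Algebra.adjoin K (Set.range (xbar 𝔭))) := by
  refine (Literature.RingTheory.NoetherNormalization.trdeg_adjoin_add_one_le_of_transcendental
    (transcendental_xbar_adjoin_ratio 𝔭 hhom hj)).trans ?_
  refine Literature.RingTheory.NoetherNormalization.trdeg_adjoin_le_trdeg_adjoin_of_forall_isAlgebraic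
    fun x hx => ?_
  have hgen : ∀ k, IsAlgebraic (Algebra.adjoin K (Set.range (xbar 𝔭))) (xbar 𝔭 k) := fun k =>
    isAlgebraic_algebraMap (⟨xbar 𝔭 k, Algebra.subset_adjoin ⟨k, rfl⟩⟩ :
      Algebra.adjoin K (Set.range (xbar 𝔭)))
  rcases hx with rfl | ⟨k, rfl⟩
  · exact hgen j
  · exact (hgen k).mul (hgen j).inv

/-- Lower bound: `trdeg K[x̄] ≤ trdeg K[x̄ₖ/x̄ⱼ : k] + 1` (`x̄ₖ = (x̄ₖ/x̄ⱼ) · x̄ⱼ`). [folklore] -/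
theorem trdeg_adjoin_range_xbar_le {j : Fin (m + 1)} (hj : (X j : MvPolynomial (Fin (m + 1)) K) ∉ 𝔭) :
    Algebra.trdeg K (Algebra.adjoin K (Set.range (xbar 𝔭))) ≤
      Algebra.trdeg K (Algebra.adjoin K (Set.range fun k : Fin (m + 1) => xbar 𝔭 k * (xbar 𝔭 j)⁻¹))
        + 1 := by
  set S : Set (FractionRing (MvPolynomial (Fin (m + 1)) K ⧸ 𝔭)) :=
    Set.range fun k : Fin (m + 1) => xbar 𝔭 k * (xbar 𝔭 j)⁻¹ with hS
  have hx : xbar 𝔭 j ≠ 0 := xbar_ne_zero 𝔭 hj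
  have hle : Algebra.adjoin K (Set.range (xbar 𝔭)) ≤ Algebra.adjoin K (S ∪ {xbar 𝔭 j}) := by
    refine Algebra.adjoin_le ?_
    rintro _ ⟨k, rfl⟩
    have e : xbar 𝔭 k = (xbar 𝔭 k * (xbar 𝔭 j)⁻¹) * xbar 𝔭 j := by
      rw [mul_assoc, inv_mul_cancel₀ hx, mul_one]
    rw [e]
    exact mul_mem (Algebra.subset_adjoin (Or.inl ⟨k, rfl⟩))
      (Algebra.subset_adjoin (Or.inr rfl))
  refine (trdeg_le_of_injective (Subalgebra.inclusion hle) (Subalgebra.inclusion_injective hle)).trans ?_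
  refine (Literature.RingTheory.NoetherNormalization.trdeg_adjoin_union_le S {xbar 𝔭 j}).trans ?_
  rw [Cardinal.mk_singleton]

/-! ### The image algebra `K[Φⱼ(u_{ik})] ⊆ Frac(K(𝔭)[U])` and its transcendence degree -/

section Main

variable [Infinite K]

omit [Infinite K] in
/-- `dim K[U]/Ī(r) = dim Φⱼ(K[U])` (first isomorphism theorem). [folklore] -/
theorem ringKrullDim_quotient_elimIdeal_eq {r : ℕ} {j : Fin (m + 1)}
    (hj : (X j : MvPolynomial (Fin (m + 1)) K) ∉ 𝔭) :
    ringKrullDim (MvPolynomial (Fin r × Fin (m + 1)) K ⧸ elimIdeal 𝔭 r) =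
      ringKrullDim ((pivotMap 𝔭 r j).comp (rename Sum.inl) :
        MvPolynomial (Fin r × Fin (m + 1)) K →ₐ[K] _).range := by
  have hker : RingHom.ker ((pivotMap 𝔭 r j).comp (rename Sum.inl) :
      MvPolynomial (Fin r × Fin (m + 1)) K →ₐ[K] _) = elimIdeal 𝔭 r := by
    rw [elimIdeal_eq_comap_ker 𝔭 hj r]
    ext G
    simp only [RingHom.mem_ker, Ideal.mem_comap, AlgHom.coe_comp, Function.comp_apply]
  rw [← hker]
  exact ringKrullDim_eq_of_ringEquiv (RingHom.quotientKerEquivRange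
    ((pivotMap 𝔭 r j).comp (rename Sum.inl) : MvPolynomial (Fin r × Fin (m + 1)) K →ₐ[K] _).toRingHom)

omit [Infinite K] in
/-- `Φⱼ(K[U])` is the `K`-algebra generated by the `Φⱼ(u_{ik})`; its transcendence degree is that
of the algebra generated by their images in `Frac(K(𝔭)[U])`. [folklore] -/
theorem trdeg_range_eq_trdeg_adjoin {r : ℕ} {j : Fin (m + 1)} :
    Algebra.trdeg K ((pivotMap 𝔭 r j).comp (rename Sum.inl) :
        MvPolynomial (Fin r × Fin (m + 1)) K →ₐ[K] _).range =
      Algebra.trdeg K (Algebra.adjoin K (Set.range fun p : Fin r × Fin (m + 1) =>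
        algebraMap _ (FractionRing (MvPolynomial (Fin r × Fin (m + 1))
          (FractionRing (MvPolynomial (Fin (m + 1)) K ⧸ 𝔭))))
          (pivotMap 𝔭 r j (X (Sum.inl p))))) := by
  have hrange : ((pivotMap 𝔭 r j).comp (rename Sum.inl) :
        MvPolynomial (Fin r × Fin (m + 1)) K →ₐ[K] _).range =
      Algebra.adjoin K (Set.range fun p : Fin r × Fin (m + 1) => pivotMap 𝔭 r j (X (Sum.inl p))) := by
    rw [← Algebra.map_top, ← MvPolynomial.adjoin_range_X, AlgHom.map_adjoin, ← Set.range_comp]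
    have : ((⇑((pivotMap 𝔭 r j).comp (rename Sum.inl) :
        MvPolynomial (Fin r × Fin (m + 1)) K →ₐ[K] _)) ∘ X) =
        fun p : Fin r × Fin (m + 1) => pivotMap 𝔭 r j (X (Sum.inl p)) := by
      funext p
      simp
    rw [this]
  rw [hrange]
  have hinj : Function.Injective (IsScalarTower.toAlgHom K
      (MvPolynomial (Fin r × Fin (m + 1)) (FractionRing (MvPolynomial (Fin (m + 1)) K ⧸ 𝔭)))
      (FractionRing (MvPolynomial (Fin r × Fin (m + 1))
        (FractionRing (MvPolynomial (Fin (m + 1)) K ⧸ 𝔭))))) :=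
    IsFractionRing.injective _ _
  have himage := Literature.RingTheory.NoetherNormalization.lift_trdeg_adjoin_image_eq
    (IsScalarTower.toAlgHom K
      (MvPolynomial (Fin r × Fin (m + 1)) (FractionRing (MvPolynomial (Fin (m + 1)) K ⧸ 𝔭)))
      (FractionRing (MvPolynomial (Fin r × Fin (m + 1))
        (FractionRing (MvPolynomial (Fin (m + 1)) K ⧸ 𝔭)))))
    hinj (Set.range fun p : Fin r × Fin (m + 1) => pivotMap 𝔭 r j (X (Sum.inl p)))
  rw [Cardinal.lift_id, Cardinal.lift_id, ← Set.range_comp] at himage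
  exact himage.symm

omit [Infinite K] in
/-- `trdeg K[x̄ₖ/x̄ⱼ : k] = r − 1` when `dim K[x̲]/𝔭 = r`. [folklore] -/
theorem trdeg_adjoin_ratio_eq (hhom : 𝔭.IsHomogeneous (homogeneousSubmodule (Fin (m + 1)) K))
    {r' : ℕ} (hdim : ringKrullDim (MvPolynomial (Fin (m + 1)) K ⧸ 𝔭) = (r' + 1 : ℕ))
    {j : Fin (m + 1)} (hj : (X j : MvPolynomial (Fin (m + 1)) K) ∉ 𝔭) :
    Algebra.trdeg K (Algebra.adjoin K (Set.range fun k : Fin (m + 1) => xbar 𝔭 k * (xbar 𝔭 j)⁻¹))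
      = (r' : Cardinal) := by
  have h1 := trdeg_adjoin_ratio_add_one_le 𝔭 hhom hj
  have h2 := trdeg_adjoin_range_xbar_le 𝔭 hj
  rw [trdeg_adjoin_range_xbar, trdeg_quotient_eq_of_ringKrullDim_eq hdim] at h1 h2
  have hfin : Algebra.trdeg K (Algebra.adjoin K (Set.range fun k : Fin (m + 1) =>
      xbar 𝔭 k * (xbar 𝔭 j)⁻¹)) ≤ (Fintype.card (Fin (m + 1)) : Cardinal) :=
    Literature.RingTheory.NoetherNormalization.trdeg_adjoin_range_le_card _
  obtain ⟨n, hn⟩ := Cardinal.lt_aleph0.1 (lt_of_le_of_lt hfin (Cardinal.natCast_lt_aleph0))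
  rw [hn] at h1 h2 ⊢
  have h1' : n + 1 ≤ r' + 1 := by exact_mod_cast h1
  have h2' : r' + 1 ≤ n + 1 := by exact_mod_cast h2
  have : n = r' := by omega
  rw [this]

omit [Infinite K] in
/-- The values `Φⱼ(u_{ik})`, pushed to `Frac(K(𝔭)[U])`: for `k ≠ j` the variable `u_{ik}` itself.
[folklore] -/
theorem algebraMap_pivotMap_X_inl_of_ne {r' : ℕ} {j : Fin (m + 1)} (i : Fin (r' + 1))
    {k : Fin (m + 1)} (hk : k ≠ j) :
    algebraMap (MvPolynomial (Fin (r' + 1) × Fin (m + 1)) (FractionRing (MvPolynomial (Fin (m + 1)) K ⧸ 𝔭))) (FractionRing (MvPolynomial (Fin (r' + 1) × Fin (m + 1)) (FractionRing (MvPolynomial (Fin (m + 1)) K ⧸ 𝔭)))) (pivotMap 𝔭 (r' + 1) j (X (Sum.inl (i, k)))) = algebraMap (MvPolynomial (Fin (r' + 1) × Fin (m + 1)) (FractionRing (MvPolynomial (Fin (m + 1)) K ⧸ 𝔭))) (FractionRing (MvPolynomial (Fin (r' + 1) × Fin (m + 1)) (FractionRing (MvPolynomial (Fin (m + 1)) K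 ⧸ 𝔭)))) (X (i, k)) := by
  rw [pivotMap_X_inl_of_ne 𝔭 j hk]

omit [Infinite K] in
/-- The values `Φⱼ(u_{ij})`, pushed to `Frac(K(𝔭)[U])`: the generic forms
`−∑_{k ≠ j} (x̄ₖ/x̄ⱼ) u_{ik}`. [folklore] -/
theorem algebraMap_pivotMap_X_inl_self {r' : ℕ} {j : Fin (m + 1)} (i : Fin (r' + 1)) :
    algebraMap (MvPolynomial (Fin (r' + 1) × Fin (m + 1)) (FractionRing (MvPolynomial (Fin (m + 1)) K ⧸ 𝔭))) (FractionRing (MvPolynomial (Fin (r' + 1) × Fin (m + 1)) (FractionRing (MvPolynomial (Fin (m + 1)) K ⧸ 𝔭)))) (pivotMap 𝔭 (r' + 1) j (X (Sum.inl (i, j)))) =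
      ∑ k : {k : Fin (m + 1) // k ≠ j},
        algebraMap (FractionRing (MvPolynomial (Fin (m + 1)) K ⧸ 𝔭)) (FractionRing (MvPolynomial (Fin (r' + 1) × Fin (m + 1)) (FractionRing (MvPolynomial (Fin (m + 1)) K ⧸ 𝔭)))) (-(xbar 𝔭 k * (xbar 𝔭 j)⁻¹)) * algebraMap (MvPolynomial (Fin (r' + 1) × Fin (m + 1)) (FractionRing (MvPolynomial (Fin (m + 1)) K ⧸ 𝔭))) (FractionRing (MvPolynomial (Fin (r' + 1) × Fin (m + 1)) (FractionRing (MvPolynomial (Fin (m + 1)) K ⧸ 𝔭)))) (X (i, (k : Fin (m + 1)))) := by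
  rw [pivotMap_X_inl_self, ← Finset.sum_subtype (Finset.univ.erase j)
    (p := fun k : Fin (m + 1) => k ≠ j) (fun k => by simp)
    (fun k => algebraMap (FractionRing (MvPolynomial (Fin (m + 1)) K ⧸ 𝔭)) (FractionRing (MvPolynomial (Fin (r' + 1) × Fin (m + 1)) (FractionRing (MvPolynomial (Fin (m + 1)) K ⧸ 𝔭)))) (-(xbar 𝔭 k * (xbar 𝔭 j)⁻¹)) * algebraMap (MvPolynomial (Fin (r' + 1) × Fin (m + 1)) (FractionRing (MvPolynomial (Fin (m + 1)) K ⧸ 𝔭))) (FractionRing (MvPolynomial (Fin (r' + 1) × Fin (m + 1)) (FractionRing (MvPolynomial (Fin (m + 1)) K ⧸ 𝔭)))) (X (i, k)))]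
  have haDC : ∀ y : (FractionRing (MvPolynomial (Fin (m + 1)) K ⧸ 𝔭)), algebraMap (MvPolynomial (Fin (r' + 1) × Fin (m + 1)) (FractionRing (MvPolynomial (Fin (m + 1)) K ⧸ 𝔭))) (FractionRing (MvPolynomial (Fin (r' + 1) × Fin (m + 1)) (FractionRing (MvPolynomial (Fin (m + 1)) K ⧸ 𝔭)))) (C y) = algebraMap (FractionRing (MvPolynomial (Fin (m + 1)) K ⧸ 𝔭)) (FractionRing (MvPolynomial (Fin (r' + 1) × Fin (m + 1)) (FractionRing (MvPolynomial (Fin (m + 1)) K ⧸ 𝔭)))) y := fun y => by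
    rw [IsScalarTower.algebraMap_apply (FractionRing (MvPolynomial (Fin (m + 1)) K ⧸ 𝔭)) (MvPolynomial (Fin (r' + 1) × Fin (m + 1)) (FractionRing (MvPolynomial (Fin (m + 1)) K ⧸ 𝔭))) (FractionRing (MvPolynomial (Fin (r' + 1) × Fin (m + 1)) (FractionRing (MvPolynomial (Fin (m + 1)) K ⧸ 𝔭))))]
    rfl
  simp only [map_mul, map_neg, map_sum, haDC, Finset.sum_mul, ← Finset.sum_neg_distrib]
  refine Finset.sum_congr rfl fun k _ => ?_
  ring

omit [Infinite K] in
/-- **Upper bound** `trdeg K[Φⱼ(u_{ik})] ≤ rm + (r − 1)`: the image algebra lies in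
`K[x̄ₖ/x̄ⱼ, u_{ik} (k ≠ j)]`. [folklore] -/
theorem trdeg_adjoin_pivot_le (hhom : 𝔭.IsHomogeneous (homogeneousSubmodule (Fin (m + 1)) K))
    {r' : ℕ} (hdim : ringKrullDim (MvPolynomial (Fin (m + 1)) K ⧸ 𝔭) = (r' + 1 : ℕ))
    {j : Fin (m + 1)} (hj : (X j : MvPolynomial (Fin (m + 1)) K) ∉ 𝔭) :
    Algebra.trdeg K (Algebra.adjoin K (Set.range fun p : Fin (r' + 1) × Fin (m + 1) =>
        algebraMap (MvPolynomial (Fin (r' + 1) × Fin (m + 1)) (FractionRing (MvPolynomial (Fin (m + 1)) K ⧸ 𝔭))) (FractionRing (MvPolynomial (Fin (r' + 1) × Fin (m + 1)) (FractionRing (MvPolynomial (Fin (m + 1)) K ⧸ 𝔭)))) (pivotMap 𝔭 (r' + 1) j (X (Sum.inl p))))) ≤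
      (((r' + 1) * m + r' : ℕ) : Cardinal) := by
  classical
  have haLinj : Function.Injective (IsScalarTower.toAlgHom K (FractionRing (MvPolynomial (Fin (m + 1)) K ⧸ 𝔭)) (FractionRing (MvPolynomial (Fin (r' + 1) × Fin (m + 1)) (FractionRing (MvPolynomial (Fin (m + 1)) K ⧸ 𝔭))))) := by
    rw [IsScalarTower.coe_toAlgHom', IsScalarTower.algebraMap_eq (FractionRing (MvPolynomial (Fin (m + 1)) K ⧸ 𝔭)) (MvPolynomial (Fin (r' + 1) × Fin (m + 1)) (FractionRing (MvPolynomial (Fin (m + 1)) K ⧸ 𝔭))) (FractionRing (MvPolynomial (Fin (r' + 1) × Fin (m + 1)) (FractionRing (MvPolynomial (Fin (m + 1)) K ⧸ 𝔭))))]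
    exact (IsFractionRing.injective (MvPolynomial (Fin (r' + 1) × Fin (m + 1)) (FractionRing (MvPolynomial (Fin (m + 1)) K ⧸ 𝔭))) (FractionRing (MvPolynomial (Fin (r' + 1) × Fin (m + 1)) (FractionRing (MvPolynomial (Fin (m + 1)) K ⧸ 𝔭))))).comp (C_injective _ _)
  -- the image algebra lies in `K[ratios, u_{ik} (k ≠ j)]`
  have hsub : Algebra.adjoin K (Set.range fun p : Fin (r' + 1) × Fin (m + 1) =>
        algebraMap (MvPolynomial (Fin (r' + 1) × Fin (m + 1)) (FractionRing (MvPolynomial (Fin (m + 1)) K ⧸ 𝔭))) (FractionRing (MvPolynomial (Fin (r' + 1) × Fin (m + 1)) (FractionRing (MvPolynomial (Fin (m + 1)) K ⧸ 𝔭)))) (pivotMap 𝔭 (r' + 1) j (X (Sum.inl p)))) ≤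
      Algebra.adjoin K (Set.range (fun k : Fin (m + 1) => algebraMap (FractionRing (MvPolynomial (Fin (m + 1)) K ⧸ 𝔭)) (FractionRing (MvPolynomial (Fin (r' + 1) × Fin (m + 1)) (FractionRing (MvPolynomial (Fin (m + 1)) K ⧸ 𝔭)))) (xbar 𝔭 k * (xbar 𝔭 j)⁻¹)) ∪
        Set.range (fun p : Fin (r' + 1) × {k : Fin (m + 1) // k ≠ j} =>
          algebraMap (MvPolynomial (Fin (r' + 1) × Fin (m + 1)) (FractionRing (MvPolynomial (Fin (m + 1)) K ⧸ 𝔭))) (FractionRing (MvPolynomial (Fin (r' + 1) × Fin (m + 1)) (FractionRing (MvPolynomial (Fin (m + 1)) K ⧸ 𝔭)))) (X (p.1, (p.2 : Fin (m + 1)))))) := by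
    refine Algebra.adjoin_le ?_
    rintro _ ⟨⟨i, k⟩, rfl⟩
    dsimp only
    by_cases hk : k = j
    · rw [hk, algebraMap_pivotMap_X_inl_self 𝔭 i]
      refine Subalgebra.sum_mem _ fun k' _ => mul_mem ?_ ?_
      · rw [map_neg (algebraMap (FractionRing (MvPolynomial (Fin (m + 1)) K ⧸ 𝔭)) (FractionRing (MvPolynomial (Fin (r' + 1) × Fin (m + 1)) (FractionRing (MvPolynomial (Fin (m + 1)) K ⧸ 𝔭)))))]
        exact neg_mem (Algebra.subset_adjoin (Or.inl ⟨(k' : Fin (m + 1)), rfl⟩))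
      · exact Algebra.subset_adjoin (Or.inr ⟨(i, k'), rfl⟩)
    · rw [algebraMap_pivotMap_X_inl_of_ne 𝔭 i hk]
      exact Algebra.subset_adjoin (Or.inr ⟨(i, ⟨k, hk⟩), rfl⟩)
  refine (trdeg_le_of_injective (Subalgebra.inclusion hsub) (Subalgebra.inclusion_injective hsub)).trans ?_
  refine (Literature.RingTheory.NoetherNormalization.trdeg_adjoin_union_le _ _).trans ?_
  -- the ratios contribute `r'`
  have hrat : Algebra.trdeg K (Algebra.adjoin K (Set.range fun k : Fin (m + 1) =>
      algebraMap (FractionRing (MvPolynomial (Fin (m + 1)) K ⧸ 𝔭)) (FractionRing (MvPolynomial (Fin (r' + 1) × Fin (m + 1)) (FractionRing (MvPolynomial (Fin (m + 1)) K ⧸ 𝔭)))) (xbar 𝔭 k * (xbar 𝔭 j)⁻¹))) = (r' : Cardinal) := by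
    have himage := Literature.RingTheory.NoetherNormalization.lift_trdeg_adjoin_image_eq
      (IsScalarTower.toAlgHom K (FractionRing (MvPolynomial (Fin (m + 1)) K ⧸ 𝔭)) (FractionRing (MvPolynomial (Fin (r' + 1) × Fin (m + 1)) (FractionRing (MvPolynomial (Fin (m + 1)) K ⧸ 𝔭))))) haLinj (Set.range fun k : Fin (m + 1) => xbar 𝔭 k * (xbar 𝔭 j)⁻¹)
    rw [Cardinal.lift_id, Cardinal.lift_id, ← Set.range_comp, trdeg_adjoin_ratio_eq 𝔭 hhom hdim hj]
      at himage
    exact himage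
  -- the variables contribute at most `(r' + 1) m`
  have hcardι : Fintype.card {k : Fin (m + 1) // k ≠ j} = m := by simp
  have hU : #(Set.range (fun p : Fin (r' + 1) × {k : Fin (m + 1) // k ≠ j} =>
      algebraMap (MvPolynomial (Fin (r' + 1) × Fin (m + 1)) (FractionRing (MvPolynomial (Fin (m + 1)) K ⧸ 𝔭))) (FractionRing (MvPolynomial (Fin (r' + 1) × Fin (m + 1)) (FractionRing (MvPolynomial (Fin (m + 1)) K ⧸ 𝔭)))) (X (p.1, (p.2 : Fin (m + 1)))))) ≤ (((r' + 1) * m : ℕ) : Cardinal) := by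
    have h2 := Cardinal.mk_range_le_lift (f := fun p : Fin (r' + 1) × {k : Fin (m + 1) // k ≠ j} =>
      algebraMap (MvPolynomial (Fin (r' + 1) × Fin (m + 1)) (FractionRing (MvPolynomial (Fin (m + 1)) K ⧸ 𝔭))) (FractionRing (MvPolynomial (Fin (r' + 1) × Fin (m + 1)) (FractionRing (MvPolynomial (Fin (m + 1)) K ⧸ 𝔭)))) (X (p.1, (p.2 : Fin (m + 1)))))
    rw [Cardinal.mk_fintype (Fin (r' + 1) × {k : Fin (m + 1) // k ≠ j}), Cardinal.lift_natCast,
      Fintype.card_prod, Fintype.card_fin, hcardι] at h2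
    exact Cardinal.lift_le.1 (h2.trans_eq (Cardinal.lift_natCast _).symm)
  calc _ ≤ (r' : Cardinal) + (((r' + 1) * m : ℕ) : Cardinal) := add_le_add hrat.le hU
    _ = (((r' + 1) * m + r' : ℕ) : Cardinal) := by push_cast; ring

/-- **Lower bound** `rm + (r − 1) ≤ trdeg K[Φⱼ(u_{ik})]`: the `rm` variables `u_{ik}` (`k ≠ j`)
and the `r − 1` generic forms `Φⱼ(u_{ij})`, `i < r − 1`, are algebraically independent over `K`
(`algebraicIndependent_sumElim_genericLinearForms'`). [folklore] -/
theorem le_trdeg_adjoin_pivot (hhom : 𝔭.IsHomogeneous (homogeneousSubmodule (Fin (m + 1)) K))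
    {r' : ℕ} (hdim : ringKrullDim (MvPolynomial (Fin (m + 1)) K ⧸ 𝔭) = (r' + 1 : ℕ))
    {j : Fin (m + 1)} (hj : (X j : MvPolynomial (Fin (m + 1)) K) ∉ 𝔭) :
    (((r' + 1) * m + r' : ℕ) : Cardinal) ≤
      Algebra.trdeg K (Algebra.adjoin K (Set.range fun p : Fin (r' + 1) × Fin (m + 1) =>
        algebraMap (MvPolynomial (Fin (r' + 1) × Fin (m + 1)) (FractionRing (MvPolynomial (Fin (m + 1)) K ⧸ 𝔭))) (FractionRing (MvPolynomial (Fin (r' + 1) × Fin (m + 1)) (FractionRing (MvPolynomial (Fin (m + 1)) K ⧸ 𝔭)))) (pivotMap 𝔭 (r' + 1) j (X (Sum.inl p))))) := by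
  classical
  have hx : xbar 𝔭 j ≠ 0 := xbar_ne_zero 𝔭 hj
  -- rows: `Fin r' ⊕ Fin 1 → Fin (r' + 1)`
  have hemb : Function.Injective (fun p : (Fin r' ⊕ Fin 1) × {k : Fin (m + 1) // k ≠ j} =>
      ((Sum.elim Fin.castSucc (fun _ => Fin.last r') p.1 : Fin (r' + 1)), (p.2 : Fin (m + 1)))) := by
    rintro ⟨a, k⟩ ⟨a', k'⟩ h
    simp only [Prod.mk.injEq] at h
    obtain ⟨h1, h2⟩ := h
    have hk : k = k' := Subtype.ext h2
    subst hk
    rcases a with i | i <;> rcases a' with i' | i'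
    · simp only [Sum.elim_inl] at h1
      rw [Fin.castSucc_inj.1 h1]
    · simp only [Sum.elim_inl, Sum.elim_inr] at h1
      exact absurd h1 (Fin.castSucc_lt_last i).ne
    · simp only [Sum.elim_inl, Sum.elim_inr] at h1
      exact absurd h1.symm (Fin.castSucc_lt_last i').ne
    · rw [Subsingleton.elim i i']
  -- the variables `u_{ρ k}`, `k ≠ j`, all rows
  have hu : AlgebraicIndependent (FractionRing (MvPolynomial (Fin (m + 1)) K ⧸ 𝔭)) (fun p : (Fin r' ⊕ Fin 1) × {k : Fin (m + 1) // k ≠ j} =>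
      algebraMap (MvPolynomial (Fin (r' + 1) × Fin (m + 1)) (FractionRing (MvPolynomial (Fin (m + 1)) K ⧸ 𝔭))) (FractionRing (MvPolynomial (Fin (r' + 1) × Fin (m + 1)) (FractionRing (MvPolynomial (Fin (m + 1)) K ⧸ 𝔭)))) (X ((Sum.elim Fin.castSucc (fun _ => Fin.last r') p.1 : Fin (r' + 1)),
        (p.2 : Fin (m + 1))))) := by
    have hX := MvPolynomial.algebraicIndependent_X (Fin (r' + 1) × Fin (m + 1)) (FractionRing (MvPolynomial (Fin (m + 1)) K ⧸ 𝔭))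
    have h1 := hX.comp _ hemb
    exact h1.map' (f := IsScalarTower.toAlgHom (FractionRing (MvPolynomial (Fin (m + 1)) K ⧸ 𝔭)) (MvPolynomial (Fin (r' + 1) × Fin (m + 1)) (FractionRing (MvPolynomial (Fin (m + 1)) K ⧸ 𝔭))) (FractionRing (MvPolynomial (Fin (r' + 1) × Fin (m + 1)) (FractionRing (MvPolynomial (Fin (m + 1)) K ⧸ 𝔭))))) (IsFractionRing.injective (MvPolynomial (Fin (r' + 1) × Fin (m + 1)) (FractionRing (MvPolynomial (Fin (m + 1)) K ⧸ 𝔭))) (FractionRing (MvPolynomial (Fin (r' + 1) × Fin (m + 1)) (FractionRing (MvPolynomial (Fin (m + 1)) K ⧸ 𝔭)))))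
  -- `K[−x̄ₖ/x̄ⱼ : k ≠ j] = K[x̄ₖ/x̄ⱼ : k]`
  have hadj : Algebra.adjoin K (Set.range fun k : {k : Fin (m + 1) // k ≠ j} =>
      -(xbar 𝔭 k * (xbar 𝔭 j)⁻¹)) =
      Algebra.adjoin K (Set.range fun k : Fin (m + 1) => xbar 𝔭 k * (xbar 𝔭 j)⁻¹) := by
    apply le_antisymm
    · refine Algebra.adjoin_le ?_
      rintro _ ⟨k, rfl⟩
      dsimp only
      exact neg_mem (Algebra.subset_adjoin ⟨(k : Fin (m + 1)), rfl⟩)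
    · refine Algebra.adjoin_le ?_
      rintro _ ⟨k, rfl⟩
      dsimp only
      by_cases hk : k = j
      · rw [hk]
        have : xbar 𝔭 j * (xbar 𝔭 j)⁻¹ = 1 := mul_inv_cancel₀ hx
        rw [this]
        exact one_mem _
      · have : xbar 𝔭 k * (xbar 𝔭 j)⁻¹ = -(-(xbar 𝔭 k * (xbar 𝔭 j)⁻¹)) := (neg_neg _).symm
        rw [this]
        exact neg_mem (Algebra.subset_adjoin ⟨⟨k, hk⟩, rfl⟩)
  have hs : ((r' : ℕ) : Cardinal) ≤ Algebra.trdeg K (Algebra.adjoin K (Set.range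
      fun k : {k : Fin (m + 1) // k ≠ j} => -(xbar 𝔭 k * (xbar 𝔭 j)⁻¹))) := by
    rw [hadj, trdeg_adjoin_ratio_eq 𝔭 hhom hdim hj]
  have hind := Literature.RingTheory.NoetherNormalization.algebraicIndependent_sumElim_genericLinearForms'
    (K := K) (fun k : {k : Fin (m + 1) // k ≠ j} => -(xbar 𝔭 k * (xbar 𝔭 j)⁻¹)) _ hu hs
  -- all these elements lie in the image algebra
  have hmem : ∀ v, Sum.elim
      (fun p : (Fin r' ⊕ Fin 1) × {k : Fin (m + 1) // k ≠ j} =>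
        algebraMap (MvPolynomial (Fin (r' + 1) × Fin (m + 1)) (FractionRing (MvPolynomial (Fin (m + 1)) K ⧸ 𝔭))) (FractionRing (MvPolynomial (Fin (r' + 1) × Fin (m + 1)) (FractionRing (MvPolynomial (Fin (m + 1)) K ⧸ 𝔭)))) (X ((Sum.elim Fin.castSucc (fun _ => Fin.last r') p.1 : Fin (r' + 1)),
          (p.2 : Fin (m + 1)))))
      (fun i : Fin r' => ∑ k : {k : Fin (m + 1) // k ≠ j},
        algebraMap (FractionRing (MvPolynomial (Fin (m + 1)) K ⧸ 𝔭)) (FractionRing (MvPolynomial (Fin (r' + 1) × Fin (m + 1)) (FractionRing (MvPolynomial (Fin (m + 1)) K ⧸ 𝔭)))) (-(xbar 𝔭 k * (xbar 𝔭 j)⁻¹)) *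
          algebraMap (MvPolynomial (Fin (r' + 1) × Fin (m + 1)) (FractionRing (MvPolynomial (Fin (m + 1)) K ⧸ 𝔭))) (FractionRing (MvPolynomial (Fin (r' + 1) × Fin (m + 1)) (FractionRing (MvPolynomial (Fin (m + 1)) K ⧸ 𝔭)))) (X ((Sum.elim Fin.castSucc (fun _ => Fin.last r')
            (Sum.inl i : Fin r' ⊕ Fin 1) : Fin (r' + 1)), (k : Fin (m + 1))))) v ∈
      Algebra.adjoin K (Set.range fun p : Fin (r' + 1) × Fin (m + 1) =>
        algebraMap (MvPolynomial (Fin (r' + 1) × Fin (m + 1)) (FractionRing (MvPolynomial (Fin (m + 1)) K ⧸ 𝔭))) (FractionRing (MvPolynomial (Fin (r' + 1) × Fin (m + 1)) (FractionRing (MvPolynomial (Fin (m + 1)) K ⧸ 𝔭)))) (pivotMap 𝔭 (r' + 1) j (X (Sum.inl p)))) := by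
    rintro (⟨ρ, k⟩ | i)
    · simp only [Sum.elim_inl]
      rw [← algebraMap_pivotMap_X_inl_of_ne 𝔭 _ k.2]
      exact Algebra.subset_adjoin ⟨_, rfl⟩
    · simp only [Sum.elim_inr, Sum.elim_inl]
      rw [← algebraMap_pivotMap_X_inl_self 𝔭 (Fin.castSucc i)]
      exact Algebra.subset_adjoin ⟨_, rfl⟩
  have hind' := AlgebraicIndependent.of_comp
    (Algebra.adjoin K (Set.range fun p : Fin (r' + 1) × Fin (m + 1) =>
        algebraMap (MvPolynomial (Fin (r' + 1) × Fin (m + 1)) (FractionRing (MvPolynomial (Fin (m + 1)) K ⧸ 𝔭))) (FractionRing (MvPolynomial (Fin (r' + 1) × Fin (m + 1)) (FractionRing (MvPolynomial (Fin (m + 1)) K ⧸ 𝔭)))) (pivotMap 𝔭 (r' + 1) j (X (Sum.inl p))))).val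
    (x := fun v => (⟨_, hmem v⟩ : Algebra.adjoin K (Set.range fun p : Fin (r' + 1) × Fin (m + 1) =>
        algebraMap (MvPolynomial (Fin (r' + 1) × Fin (m + 1)) (FractionRing (MvPolynomial (Fin (m + 1)) K ⧸ 𝔭))) (FractionRing (MvPolynomial (Fin (r' + 1) × Fin (m + 1)) (FractionRing (MvPolynomial (Fin (m + 1)) K ⧸ 𝔭)))) (pivotMap 𝔭 (r' + 1) j (X (Sum.inl p)))))) hind
  have hlower := hind'.lift_cardinalMk_le_trdeg
  have hcardι : Fintype.card {k : Fin (m + 1) // k ≠ j} = m := by simp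
  have hcard : Fintype.card (((Fin r' ⊕ Fin 1) × {k : Fin (m + 1) // k ≠ j}) ⊕ Fin r') =
      (r' + 1) * m + r' := by
    simp only [Fintype.card_sum, Fintype.card_prod, Fintype.card_fin, hcardι]
  rw [Cardinal.mk_fintype, hcard, Cardinal.lift_natCast] at hlower
  exact Cardinal.lift_le.1 ((Cardinal.lift_natCast _).trans_le hlower)

/-! ### Conclusion: `Ī(r)` is a non-zero prime of height one, hence principal -/

/-- **`dim K[U]/p̄(r) = r(m+1) − 1`** for a homogeneous prime `𝔭 ⊂ K[x₀, …, x_m]` with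
`dim K[x̲]/𝔭 = r ≥ 1` (`K` infinite): the variety of the Chow form is a hypersurface.
[cite: NesterenkoPhilippon2001, Ch. 3 Prop. 4.4 (p. 38)] -/
theorem ringKrullDim_quotient_elimIdeal (hhom : 𝔭.IsHomogeneous (homogeneousSubmodule (Fin (m + 1)) K))
    {r : ℕ} (hr : 1 ≤ r) (hdim : ringKrullDim (MvPolynomial (Fin (m + 1)) K ⧸ 𝔭) = r) :
    ringKrullDim (MvPolynomial (Fin r × Fin (m + 1)) K ⧸ elimIdeal 𝔭 r) = (r * m + r - 1 : ℕ) := by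
  classical
  obtain ⟨r', rfl⟩ : ∃ r', r = r' + 1 := ⟨r - 1, by omega⟩
  have hdim0 : ringKrullDim (MvPolynomial (Fin (m + 1)) K ⧸ 𝔭) ≠ 0 := by
    rw [hdim]; exact_mod_cast Nat.succ_ne_zero r'
  obtain ⟨j, hj⟩ := Literature.RingTheory.MvPolynomial.exists_X_notMem_of_ringKrullDim_ne_zero hdim0
  rw [ringKrullDim_quotient_elimIdeal_eq 𝔭 hj]
  -- the image algebra is an affine domain
  haveI : Algebra.FiniteType K ((pivotMap 𝔭 (r' + 1) j).comp (rename Sum.inl) :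
      MvPolynomial (Fin (r' + 1) × Fin (m + 1)) K →ₐ[K] _).range :=
    Algebra.FiniteType.of_surjective
      ((pivotMap 𝔭 (r' + 1) j).comp (rename Sum.inl) :
        MvPolynomial (Fin (r' + 1) × Fin (m + 1)) K →ₐ[K] _).rangeRestrict
      (AlgHom.rangeRestrict_surjective _)
  rw [Literature.RingTheory.KrullDimension.ringKrullDim_eq_trdeg K
    ((pivotMap 𝔭 (r' + 1) j).comp (rename Sum.inl) :
        MvPolynomial (Fin (r' + 1) × Fin (m + 1)) K →ₐ[K] _).range,
    trdeg_range_eq_trdeg_adjoin 𝔭]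
  have h := le_antisymm (trdeg_adjoin_pivot_le 𝔭 hhom hdim hj) (le_trdeg_adjoin_pivot 𝔭 hhom hdim hj)
  rw [h, Cardinal.toNat_natCast]
  congr 1

/-- **`Ī(r)` has height one** (for `𝔭` homogeneous prime with `dim K[x̲]/𝔭 = r ≥ 1`, `K`
infinite). [cite: NesterenkoPhilippon2001, Ch. 3 Prop. 4.4 (p. 38)] -/
theorem height_elimIdeal_eq_one (hhom : 𝔭.IsHomogeneous (homogeneousSubmodule (Fin (m + 1)) K))
    {r : ℕ} (hr : 1 ≤ r) (hdim : ringKrullDim (MvPolynomial (Fin (m + 1)) K ⧸ 𝔭) = r) :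
    (elimIdeal 𝔭 r).height = 1 := by
  have hdim0 : ringKrullDim (MvPolynomial (Fin (m + 1)) K ⧸ 𝔭) ≠ 0 := by
    rw [hdim]; exact_mod_cast (by omega : r ≠ 0)
  obtain ⟨j, hj⟩ := Literature.RingTheory.MvPolynomial.exists_X_notMem_of_ringKrullDim_ne_zero hdim0
  haveI : (elimIdeal 𝔭 r).IsPrime := isPrime_elimIdeal 𝔭 hj r
  have hformula := Literature.RingTheory.KrullDimension.ringKrullDim_quotient_add_height K
    (elimIdeal 𝔭 r)
  rw [ringKrullDim_quotient_elimIdeal 𝔭 hhom hr hdim, MvPolynomial.ringKrullDim_of_isNoetherianRing,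
    ringKrullDim_eq_zero_of_field, zero_add, Nat.card_eq_fintype_card, Fintype.card_prod,
    Fintype.card_fin, Fintype.card_fin] at hformula
  -- strip `WithBot`: everything is a natural number
  have hf2 : ((r * m + r - 1 : ℕ) : ℕ∞) + (elimIdeal 𝔭 r).height = ((r * (m + 1) : ℕ) : ℕ∞) := by
    have h1 := hformula
    rw [← WithBot.coe_natCast, ← WithBot.coe_natCast, ← WithBot.coe_add, WithBot.coe_inj] at h1
    exact h1
  have hne : (elimIdeal 𝔭 r).height ≠ ⊤ := by
    intro htop
    rw [htop, add_top] at hf2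
    exact ENat.top_ne_coe _ hf2
  obtain ⟨h, hh⟩ := ENat.ne_top_iff_exists.1 hne
  rw [← hh] at hf2 ⊢
  have key : (r * m + r - 1) + h = r * (m + 1) := by exact_mod_cast hf2
  have : h = 1 := by
    have : r * (m + 1) = r * m + r := by ring
    omega
  rw [this]
  simp

/-- **LNM 1752 Ch. 3 Proposition 4.4, prime case** (Philippon 1986 Prop. 1.5 (ii)–(iii);
Hodge–Pedoe II Ch. X §6 Thm. I): for a homogeneous prime `𝔭 ⊂ K[x₀, …, x_m]` with
`dim K[x̲]/𝔭 = r ≥ 1` over an infinite field `K`, the elimination ideal `Ī(r) = p̄(r) ⊂ K[U]` is a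
non-zero principal prime ideal. [cite: NesterenkoPhilippon2001, Ch. 3 Prop. 4.4 (p. 38)] -/
theorem isPrincipal_elimIdeal (hhom : 𝔭.IsHomogeneous (homogeneousSubmodule (Fin (m + 1)) K))
    {r : ℕ} (hr : 1 ≤ r) (hdim : ringKrullDim (MvPolynomial (Fin (m + 1)) K ⧸ 𝔭) = r) :
    (elimIdeal 𝔭 r).IsPrincipal ∧ elimIdeal 𝔭 r ≠ ⊥ ∧ (elimIdeal 𝔭 r).IsPrime := by
  have hdim0 : ringKrullDim (MvPolynomial (Fin (m + 1)) K ⧸ 𝔭) ≠ 0 := by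
    rw [hdim]; exact_mod_cast (by omega : r ≠ 0)
  obtain ⟨j, hj⟩ := Literature.RingTheory.MvPolynomial.exists_X_notMem_of_ringKrullDim_ne_zero hdim0
  haveI : (elimIdeal 𝔭 r).IsPrime := isPrime_elimIdeal 𝔭 hj r
  have hh := height_elimIdeal_eq_one 𝔭 hhom hr hdim
  refine ⟨UniqueFactorizationMonoid.isPrincipal_of_height_eq_one hh, ?_, inferInstance⟩
  intro hbot
  rw [hbot, Ideal.height_bot] at hh
  exact zero_ne_one hh

/-- The generator of `p̄(r)` (the Chow form of `𝔭`) is a prime element of `K[U]`.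
[cite: NesterenkoPhilippon2001, Ch. 3 Prop. 4.4 (p. 38)] -/
theorem prime_generator_elimIdeal (hhom : 𝔭.IsHomogeneous (homogeneousSubmodule (Fin (m + 1)) K))
    {r : ℕ} (hr : 1 ≤ r) (hdim : ringKrullDim (MvPolynomial (Fin (m + 1)) K ⧸ 𝔭) = r)
    (hP : (elimIdeal 𝔭 r).IsPrincipal) :
    Prime (Submodule.IsPrincipal.generator (elimIdeal 𝔭 r)) := by
  obtain ⟨-, hne, hprime⟩ := isPrincipal_elimIdeal 𝔭 hhom hr hdim
  exact Submodule.IsPrincipal.prime_generator_of_isPrime _ hne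

end Main

end NesterenkoK

/-! ### Consequences for `K = ℚ` (the hypotheses (1)(first half) and (2) of `NesterenkoPhilippon2001_ch3_prop_4_4_of`) -/

namespace Nesterenko

variable {m : ℕ}

attribute [local instance] MvPolynomial.gradedAlgebra

/-- Philippon 1986 Prop. 1.3 (ii) for `K = ℚ`: `𝔭̄(r)` is prime for a prime `𝔭 ⊂ ℚ[x̲]` not
containing the irrelevant ideal `(x₀, …, x_m)` — hypothesis (1), first half, of
`NesterenkoPhilippon2001_ch3_prop_4_4_of` (`NesterenkoEliminationProofs.lean`), in its exact
form (homogeneity is not needed). [cite: NesterenkoPhilippon2001, Ch. 3 Prop. 4.4 (p. 38)] -/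
theorem isPrime_elimIdeal_of_not_span_X_le (m r : ℕ) (𝔭 : Ideal (Rx m)) (h𝔭 : 𝔭.IsPrime)
    (h : ¬ Ideal.span (Set.range (X : Fin (m + 1) → Rx m)) ≤ 𝔭) : (elimIdeal 𝔭 r).IsPrime := by
  haveI := h𝔭
  obtain ⟨j, hj⟩ : ∃ j, (X j : Rx m) ∉ 𝔭 := by
    by_contra hcon
    push Not at hcon
    exact h (Ideal.span_le.2 (by rintro _ ⟨j, rfl⟩; exact hcon j))
  exact isPrime_elimIdeal_of_X_notMem 𝔭 hj r

/-- **LNM 1752 Ch. 3 Proposition 4.4 for a prime ideal, `K = ℚ`** (Philippon 1986 Prop. 1.5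
(ii)–(iii); Hodge–Pedoe II Ch. X §6 Thm. I): for a homogeneous prime `𝔭 ⊂ ℚ[x₀, …, x_m]` with
`dim ℚ[x̲]/𝔭 = r`, `1 ≤ r ≤ m`, the ideal `p̄(r) = Ī(r) ⊂ ℚ[u₁, …, u_r]` is principal and non-zero —
hypothesis (2) of `NesterenkoPhilippon2001_ch3_prop_4_4_of` (`NesterenkoEliminationProofs.lean`),
in its exact form (`r ≤ m` is not needed). [cite: NesterenkoPhilippon2001, Ch. 3 Prop. 4.4 (p. 38)] -/
theorem isPrincipal_elimIdeal_and_ne_bot (m r : ℕ) (𝔭 : Ideal (Rx m)) (hr : 1 ≤ r) (_hrm : r ≤ m)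
    (hhom : 𝔭.IsHomogeneous (homogeneousSubmodule (Fin (m + 1)) ℚ)) (h𝔭 : 𝔭.IsPrime)
    (hdim : ringKrullDim (Rx m ⧸ 𝔭) = r) : (elimIdeal 𝔭 r).IsPrincipal ∧ elimIdeal 𝔭 r ≠ ⊥ := by
  haveI := h𝔭
  haveI : Infinite ℚ := Infinite.of_injective (Nat.cast : ℕ → ℚ) Nat.cast_injective
  rw [elimIdeal_eq]
  obtain ⟨h1, h2, -⟩ := NesterenkoK.isPrincipal_elimIdeal 𝔭 hhom hr hdim
  exact ⟨h1, h2⟩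

/-- `p̄(r)` has height one (`𝔭 ⊂ ℚ[x̲]` homogeneous prime, `dim ℚ[x̲]/𝔭 = r ≥ 1`).
[cite: NesterenkoPhilippon2001, Ch. 3 Prop. 4.4 (p. 38)] -/
theorem height_elimIdeal_eq_one (𝔭 : Ideal (Rx m)) [𝔭.IsPrime]
    (hhom : 𝔭.IsHomogeneous (homogeneousSubmodule (Fin (m + 1)) ℚ)) {r : ℕ} (hr : 1 ≤ r)
    (hdim : ringKrullDim (Rx m ⧸ 𝔭) = r) : (elimIdeal 𝔭 r).height = 1 := by
  haveI : Infinite ℚ := Infinite.of_injective (Nat.cast : ℕ → ℚ) Nat.cast_injective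
  rw [elimIdeal_eq]
  exact NesterenkoK.height_elimIdeal_eq_one 𝔭 hhom hr hdim

/-- **The Chow form of a homogeneous prime ideal is irreducible**: for `𝔭 ⊂ ℚ[x₀, …, x_m]` a
homogeneous prime with `dim ℚ[x̲]/𝔭 = r ≥ 1`, the associated form `chowForm 𝔭 r` (a generator of
the principal ideal `p̄(r)`) is a prime element of `ℚ[U]`.
[cite: NesterenkoPhilippon2001, Ch. 3 Prop. 4.4 (p. 38)] -/
theorem prime_chowForm (𝔭 : Ideal (Rx m)) [𝔭.IsPrime]
    (hhom : 𝔭.IsHomogeneous (homogeneousSubmodule (Fin (m + 1)) ℚ)) {r : ℕ} (hr : 1 ≤ r)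
    (hdim : ringKrullDim (Rx m ⧸ 𝔭) = r) : Prime (chowForm 𝔭 r) := by
  haveI : Infinite ℚ := Infinite.of_injective (Nat.cast : ℕ → ℚ) Nat.cast_injective
  obtain ⟨hP, hne, hprime⟩ := NesterenkoK.isPrincipal_elimIdeal 𝔭 hhom hr hdim
  rw [← elimIdeal_eq] at hP hne hprime
  rw [chowForm, dif_pos hP]
  haveI := hP
  haveI := hprime
  exact Submodule.IsPrincipal.prime_generator_of_isPrime _ hne

/-- In particular the Chow form of such a prime is non-zero and `p̄(r) = (chowForm 𝔭 r)`.
[cite: NesterenkoPhilippon2001, Ch. 3 Prop. 4.4 (p. 38)] -/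
theorem span_chowForm_eq_elimIdeal (𝔭 : Ideal (Rx m)) [𝔭.IsPrime]
    (hhom : 𝔭.IsHomogeneous (homogeneousSubmodule (Fin (m + 1)) ℚ)) {r : ℕ} (hr : 1 ≤ r)
    (hdim : ringKrullDim (Rx m ⧸ 𝔭) = r) :
    Ideal.span {chowForm 𝔭 r} = elimIdeal 𝔭 r ∧ chowForm 𝔭 r ≠ 0 := by
  haveI : Infinite ℚ := Infinite.of_injective (Nat.cast : ℕ → ℚ) Nat.cast_injective
  obtain ⟨hP, -, -⟩ := NesterenkoK.isPrincipal_elimIdeal 𝔭 hhom hr hdim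
  rw [← elimIdeal_eq] at hP
  exact ⟨span_chowForm 𝔭 r hP, (prime_chowForm 𝔭 hhom hr hdim).ne_zero⟩

end Nesterenko

end Literature.NumberTheory.Transcendental
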